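import Summits.QuantumFields.YangMills.Theorems.BalabanUVNodesN19HybridBeyondTarget
import Summits.QuantumFields.YangMills.Theorems.BalabanUVNodesN19SourceSplit

/-!
# BalabanUVNodes ∕ node N19 (NE7) — THE RESPONSE-HOMOGENEITY LETTER (H) FROM A CLASS-HOMOGENEOUS SHIFT OF THE TILTED INSERTION MEANS: if the two runs' source-tilted
# class means of the observable differ by a CLASS-INDEPENDENT amount up to `Λ_K`, then (H) holds at `Λ_K·l₀`, and with the DECL target and vacuum homogeneity the hybrid binder list follows

Cell `pub-ymgap` (HUMAN RULING D-0062 Track A ∕ D-0149 width seats), WIDTH SEAT `pub-ymgap-dag-n19-w1` (node n19 = NE7, seat 1 of 3), generation g3,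
INTENT-9.  Route `Summits/QuantumFields/YangMills/Theses/BalabanUVNodes.lean`, key item K3⁷ `SpineGivenEndpointR13SepCoPH` (stmt-QuantumFields-20544; N19′ conjunct of v5 stub 2); filed
`--kind proof --supports … --as helper`.  COUNT-NEUTRAL.  THEOREMS ONLY (0 `def`, 0 `sorry`).  ADDITIVE — imports this seat's g3 `…N19HybridBeyondTarget` (p602850:
`hybridNE7_of_matchingModConstants_of_vacuumOsc_of_responseOsc`) and dag-n19-e's `…N19SourceSplit` (`uIcc_subset_Icc_of_abs_le`; its `insertion_of_hasDerivWithin` is the per-class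
ancestor) ONLY (Mathlib's `Convex.norm_image_sub_le_of_norm_hasDerivWithin_le` through them); modifies nothing.

WHY.  `…N19HybridBeyondTarget` §7 split the one letter `Hom` the hybrid road asks beyond node U5's DECL target into (V₀) vacuum class-homogeneity and (H) class-homogeneity of the
SOURCE RESPONSE `X(t,τ) − X(0,τ)`, `X = log(B − shB) − log(A − shA)`.  dag-n19-e's `…N19SourceSplit` §2 derives the stronger per-class letter (I) from a bound `|mQ − mP| ≤ Λ_K` on the
difference of the two runs' TILTED INSERTION MEANS (the `t`-derivatives of the log-cores — in the dressed picture the conditional means of the observable under the class-`τ` term,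
the currency of dag-n19-w2's U3 faces for N14 and of n19-c's `TiltedMeanMatching`).  (H) needs less: the difference of tilted means may be LARGE provided it is the SAME for all good
classes up to `Λ_K` — `|(mQ − mP)(s,τ) − (mQ − mP)(s,τ′)| ≤ Λ_K` — the shape «the extra finest RG step renormalises the observable insertion by a class-independent shift» (the
analysis [Balaban1989LargeFieldII] p. 356 defers; NOT PRINTED).  This file proves (H) from that letter by the mean value inequality applied to the DIFFERENCE of two classes'
log-ratios, and plugs it into §7's converse road.
* §1 [folklore] ★★ `responseOsc_of_meanShiftOsc` — derivatives `mP`, `mQ` of the log-cores within `[−l₀, l₀]`, class-homogeneous shift `|(mQ − mP)(s,τ) − (mQ − mP)(s,τ′)| ≤ Λ_K` along the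
  source segment for good `τ, τ′` ⇒ (H) at `2·vol·ε¹_K = Λ_K·l₀` (i.e. `ε¹ = Λ·l₀∕(2·vol)`).
* §2 [folklore ∘ p602850] ★★ `hybridNE7_of_matchingModConstants_of_vacuumOsc_of_meanShiftOsc` — DECL target + NE7b + NE7c + `W+Wsh<1` + `Summable δ` + positive good cores + (V₀) summable + the
  mean-shift letter with `Summable Λ` + `0 < vol` ⇒ `HybridNE7 … (hybridDelta vol δ (W+Wsh) + 2(ε⁰ + Λ·l₀∕(2vol)))`.
READING.  On the hybrid road the observable-insertion analysis is owed only in CLASS-HOMOGENEOUS form relative to the totals: a class-independent shift of the tilted means between the runs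
(however large) costs nothing beyond the DECL target; only its class-oscillation must be summable.

HONEST FRAMING.  Elementary calculus [folklore] over hypothesis SHAPES (`mP`, `mQ`, `Λ` letters; `Core`∕`HybridNE7`∕weights as hypotheses); nothing of Bałaban's is asserted or instantiated; NE7 ∕
NE7b ∕ NE7c NOT PRINTED as two-run statements for d = 4 ∕ NOT proved; N19 NOT discharged; K3⁷ OPEN, not claimed; counts UNMOVED (typed 28∕28 · discharged 5∕27, A 5∕28).  Everything below is
PROVED (0 `sorry`, 0 named facts, standard axioms); no decl carries a cite tag.  One finite four-torus programme at fixed ε — NOT ℝ⁴, NOT infinite volume, NOT OS, NOT a mass gap, NOT the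
Clay problem (R4 closes the conditional finite-𝕋⁴ rung `BalabanLadder.UV` only).
-/

noncomputable section

open Finset Set
open scoped BigOperators

namespace Summit.QuantumFields.YangMills.BalabanUVNodes.N19HomFromMeanShift

open Literature.MathematicalPhysics.QuantumFieldTheory.Balaban1983to89
open T4CauchySum (MatchingModConstants)
open T4WeightBudget (RelWeightBound)
open T4IndicatorShell (ShellWeightBound)
open T4MatchingAssembly (HybridNE7)
open T4HybridMatching (hybridDelta)
open Summit.QuantumFields.YangMills.BalabanUVNodes.N19HybridBeyondTarget (hybridNE7_of_matchingModConstants_of_vacuumOsc_of_responseOsc)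
open Summit.QuantumFields.YangMills.BalabanUVNodes.N19SourceSplit (uIcc_subset_Icc_of_abs_le)

variable {ι : Type*} [DecidableEq ι] {l₀ vol : ℝ} {T : ℕ → Finset ι} {Bad : ℕ → ℝ → Finset ι}

/-! ## §1 (H) from a class-homogeneous shift of the tilted insertion means [folklore] -/

section MeanShift
variable {P Q : ℕ → ℝ → ι → ℝ} {mP mQ : ℕ → ℝ → ι → ℝ} {Λ : ℕ → ℝ}

/-- **★★ (H) FROM A CLASS-HOMOGENEOUS MEAN SHIFT** [folklore].  If for every class the log-cores `s ↦ log P_K(s,τ)`, `s ↦ log Q_K(s,τ)` have derivatives `mP_K(s,τ)`, `mQ_K(s,τ)` within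
`[−l₀, l₀]` (the two runs' source-tilted class means of the observable) and along the source segment the SHIFT `mQ − mP` is the same for all good classes up to `Λ_K`,
`|(mQ − mP)(s,τ) − (mQ − mP)(s,τ′)| ≤ Λ_K` (`0 ≤ Λ_K`), then the RESPONSE of the log-ratio `X = log Q − log P` is class-homogeneous: `(X(t,τ) − X(0,τ)) − (X(t,τ′) − X(0,τ′)) ≤ Λ_K·l₀`
— the mean value inequality for the difference `X(·,τ) − X(·,τ′)` on `[0, t]`. -/
theorem responseOsc_of_meanShiftOsc (hΛ : ∀ K, 0 ≤ Λ K)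
    (hdP : ∀ K, ∀ τ ∈ T K, ∀ s ∈ Set.Icc (-l₀) l₀, HasDerivWithinAt (fun s => Real.log (P K s τ)) (mP K s τ) (Set.Icc (-l₀) l₀) s)
    (hdQ : ∀ K, ∀ τ ∈ T K, ∀ s ∈ Set.Icc (-l₀) l₀, HasDerivWithinAt (fun s => Real.log (Q K s τ)) (mQ K s τ) (Set.Icc (-l₀) l₀) s)
    (hshift : ∀ (K : ℕ) (t : ℝ), |t| ≤ l₀ → ∀ τ ∈ T K \ Bad K t, ∀ τ' ∈ T K \ Bad K t, ∀ s ∈ Set.uIcc (0 : ℝ) t,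
      |(mQ K s τ - mP K s τ) - (mQ K s τ' - mP K s τ')| ≤ Λ K) :
    ∀ (K : ℕ) (t : ℝ), |t| ≤ l₀ → ∀ τ ∈ T K \ Bad K t, ∀ τ' ∈ T K \ Bad K t,
      ((Real.log (Q K t τ) - Real.log (P K t τ)) - (Real.log (Q K 0 τ) - Real.log (P K 0 τ))) -
        ((Real.log (Q K t τ') - Real.log (P K t τ')) - (Real.log (Q K 0 τ') - Real.log (P K 0 τ'))) ≤ Λ K * l₀ := by
  intro K t ht τ hτ τ' hτ'
  have hτT : τ ∈ T K := (Finset.mem_sdiff.mp hτ).1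
  have hτT' : τ' ∈ T K := (Finset.mem_sdiff.mp hτ').1
  have hsub : Set.uIcc (0 : ℝ) t ⊆ Set.Icc (-l₀) l₀ := uIcc_subset_Icc_of_abs_le ht
  have hderiv : ∀ s ∈ Set.uIcc (0 : ℝ) t,
      HasDerivWithinAt (fun s => (Real.log (Q K s τ) - Real.log (P K s τ)) - (Real.log (Q K s τ') - Real.log (P K s τ')))
        ((fun s => (mQ K s τ - mP K s τ) - (mQ K s τ' - mP K s τ')) s) (Set.uIcc (0 : ℝ) t) s := fun s hs =>
    (((hdQ K τ hτT s (hsub hs)).mono hsub).sub ((hdP K τ hτT s (hsub hs)).mono hsub)).sub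
      (((hdQ K τ' hτT' s (hsub hs)).mono hsub).sub ((hdP K τ' hτT' s (hsub hs)).mono hsub))
  have hbound : ∀ s ∈ Set.uIcc (0 : ℝ) t, ‖(fun s => (mQ K s τ - mP K s τ) - (mQ K s τ' - mP K s τ')) s‖ ≤ Λ K := fun s hs => by
    rw [Real.norm_eq_abs]
    exact hshift K t ht τ hτ τ' hτ' s hs
  have hmv := (convex_uIcc (0 : ℝ) t).norm_image_sub_le_of_norm_hasDerivWithin_le hderiv hbound Set.left_mem_uIcc Set.right_mem_uIcc
  simp only [Real.norm_eq_abs, sub_zero] at hmv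
  have h := (le_abs_self _).trans (hmv.trans (mul_le_mul_of_nonneg_left ht (hΛ K)))
  linarith

end MeanShift

/-! ## §2 Plugged into the converse road of `…N19HybridBeyondTarget` §7 [folklore ∘ p602850] -/

section Plug
variable {A B shA shB mA mB : ℕ → ℝ → ι → ℝ} {W Wsh δ ε₀ Λ : ℕ → ℝ} {Z : ℕ → ℝ → ℝ}

/-- **★★ DECL TARGET + WEIGHTS + (V₀) + CLASS-HOMOGENEOUS MEAN SHIFT ⇒ THE BINDER LIST** [folklore ∘ p602850 §7 ∘ §1].  Node U5's `MatchingModConstants vol l₀ δ Z` at positive partition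
functions with the E1∕E2 dictionary, NE7b + NE7c + `W+Wsh<1` + `Summable δ`, positive good cores, (V₀) vacuum class-homogeneity at summable rate `ε⁰`, the good cores' log
derivatives in the source (`mA`, `mB`: the two runs' tilted insertion means) with a CLASS-HOMOGENEOUS SHIFT `|(mB − mA)(s,τ) − (mB − mA)(s,τ′)| ≤ Λ_K`, `Λ ≥ 0` SUMMABLE, `0 < vol` ⇒
`HybridNE7 … (hybridDelta vol δ (W+Wsh) + 2(ε⁰ + Λ·l₀∕(2vol)))`. -/
theorem hybridNE7_of_matchingModConstants_of_vacuumOsc_of_meanShiftOsc (hvol : 0 < vol) (hW : RelWeightBound l₀ T A B Bad W)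
    (hSh : ShellWeightBound l₀ T A B shA shB Wsh) (hlt : ∀ K, W K + Wsh K < 1)
    (hZA : ∀ (K : ℕ) (t : ℝ), |t| ≤ l₀ → Z K t = ∑ τ ∈ T K, A K t τ) (hZB : ∀ (K : ℕ) (t : ℝ), |t| ≤ l₀ → Z (K + 1) t = ∑ τ ∈ T K, B K t τ)
    (hZ : ∀ (K : ℕ) (t : ℝ), |t| ≤ l₀ → 0 < Z K t) (hM : MatchingModConstants vol l₀ δ Z) (hδ : Summable δ)
    (hP : ∀ (K : ℕ) (t : ℝ), |t| ≤ l₀ → ∀ τ ∈ T K \ Bad K t, 0 < A K t τ - shA K t τ)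
    (hQ : ∀ (K : ℕ) (t : ℝ), |t| ≤ l₀ → ∀ τ ∈ T K \ Bad K t, 0 < B K t τ - shB K t τ)
    (hV : ∀ (K : ℕ) (t : ℝ), |t| ≤ l₀ → ∀ τ ∈ T K \ Bad K t, ∀ τ' ∈ T K \ Bad K t,
      (Real.log (B K 0 τ - shB K 0 τ) - Real.log (A K 0 τ - shA K 0 τ)) - (Real.log (B K 0 τ' - shB K 0 τ') - Real.log (A K 0 τ' - shA K 0 τ')) ≤ 2 * (vol * ε₀ K))
    (hε₀ : Summable ε₀) (hΛ0 : ∀ K, 0 ≤ Λ K) (hΛ : Summable Λ)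
    (hdA : ∀ K, ∀ τ ∈ T K, ∀ s ∈ Set.Icc (-l₀) l₀, HasDerivWithinAt (fun s => Real.log (A K s τ - shA K s τ)) (mA K s τ) (Set.Icc (-l₀) l₀) s)
    (hdB : ∀ K, ∀ τ ∈ T K, ∀ s ∈ Set.Icc (-l₀) l₀, HasDerivWithinAt (fun s => Real.log (B K s τ - shB K s τ)) (mB K s τ) (Set.Icc (-l₀) l₀) s)
    (hshift : ∀ (K : ℕ) (t : ℝ), |t| ≤ l₀ → ∀ τ ∈ T K \ Bad K t, ∀ τ' ∈ T K \ Bad K t, ∀ s ∈ Set.uIcc (0 : ℝ) t,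
      |(mB K s τ - mA K s τ) - (mB K s τ' - mA K s τ')| ≤ Λ K) :
    HybridNE7 l₀ vol T A B Bad W shA shB Wsh (fun K => hybridDelta vol δ (fun K => W K + Wsh K) K + 2 * (ε₀ K + Λ K * l₀ / (2 * vol))) := by
  refine hybridNE7_of_matchingModConstants_of_vacuumOsc_of_responseOsc hvol hW hSh hlt hZA hZB hZ hM hδ hP hQ hV (fun K t ht τ hτ τ' hτ' => ?_) hε₀
    ((hΛ.mul_right l₀).div_const (2 * vol))
  have e : 2 * (vol * (Λ K * l₀ / (2 * vol))) = Λ K * l₀ := by field_simp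
  rw [e]
  exact responseOsc_of_meanShiftOsc (P := fun K s τ => A K s τ - shA K s τ) (Q := fun K s τ => B K s τ - shB K s τ) hΛ0 hdA hdB hshift K t ht τ hτ τ' hτ'

end Plug


end Summit.QuantumFields.YangMills.BalabanUVNodes.N19HomFromMeanShift

end
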